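import Mathlib
import Summits.Ventures.HodgeRepro2.T5LocalUnitHilbert90

/-!
# The unramified integral basis `S = R ⊕ R θ` from finiteness, `e = 1` and residue degree `2`

The files `T5FiltrationHilbert90` / `T5NormOneQuotientOrder` / `T5LocalUnitHilbert90` take the
unramified integral basis as a HYPOTHESIS: `θ ∈ S` with `θ − σ θ` a unit and every `s ∈ S` of the
form `a + b θ` (`a, b ∈ R`).  Here both clauses are DERIVED:

* `exists_eq_add_mul_of_residue` (NAKAYAMA): `S` a finite module over the local ring `R`,
  `𝔪_S ⊆ ϖ S` for some `ϖ ∈ 𝔪_R` (ramification index `1`); if `1, θ` span `S` modulo `𝔪_S`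
  then they generate `S` over `R`;
* `surjective_add_mul_of_card`: a finite field of order `q²` over a subfield of order `q` is
  spanned by `1, t` for ANY `t` outside the subfield (an injective map `K × K → L` between sets of
  the same cardinality `q²` is onto);
* `exists_sub_mem_maximalIdeal_of_card`: hence `1, θ` span `S` modulo `𝔪_S` as soon as
  `|k_R| = q`, `|k_S| = q²` and `θ̄ ∉ k_R`;
* `exists_eq_add_mul`: the integral basis on a pair of DVRs with `Irreducible ϖ`,
  `Irreducible (algebraMap ϖ)` (`e = 1`), `Module.Finite R S`, residue cardinalities `q`, `q²`,
  `θ̄ ∉ k_R`;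
* `isUnit_sub_conj`: `θ − σ θ` is a unit as soon as its residue is non-zero;
* the capstones of N5.15.2 (A15) / N5.T3 (`(q+1)q^{n−1}`, `(q+1)q`, `q+1`, `q`) restated on these
  hypotheses alone (`relIndex_range_inf_higherUnits_eq` / `_two` / `_one`,
  `relIndex_inf_two_inf_one`), the unit cardinalities `q − 1`, `q² − 1` now DERIVED
  (`Nat.card_units`).

Declaration per README §8(d): «uses an L-value-free non-vanishing device: NO».
-/

namespace Summit.Ventures.HodgeRepro2.T5UnramifiedIntegralBasis

open T5FiltrationHilbert90 T5PrincipalUnitFiltration T5PrincipalUnitComparison IsLocalRing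

section Nakayama

variable {R S : Type*} [CommRing R] [CommRing S] [Algebra R S] [IsLocalRing R] [IsLocalRing S]

/-- NAKAYAMA: `S` finite over the local ring `R`, `𝔪_S ⊆ ϖ S` with `ϖ ∈ 𝔪_R`; if `1, θ` span `S`
modulo `𝔪_S`, they generate `S` over `R`. -/
theorem exists_eq_add_mul_of_residue [Module.Finite R S] {ϖ : R} (hϖ : ϖ ∈ maximalIdeal R)
    (hmax : ∀ s ∈ maximalIdeal S, ∃ t : S, s = algebraMap R S ϖ * t) {θ : S}
    (hres : ∀ s : S, ∃ a b : R, s - (algebraMap R S a + algebraMap R S b * θ) ∈ maximalIdeal S) :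
    ∀ s : S, ∃ a b : R, s = algebraMap R S a + algebraMap R S b * θ := by
  have key : (⊤ : Submodule R S) ≤ Submodule.span R {(1 : S), θ} := by
    refine Submodule.le_of_le_smul_of_le_jacobson_bot (I := Ideal.span {ϖ}) Module.Finite.fg_top
      ?_ ?_
    · rw [IsLocalRing.jacobson_eq_maximalIdeal ⊥ bot_ne_top]
      exact (Ideal.span_singleton_le_iff_mem _).2 hϖ
    · intro s _
      obtain ⟨a, b, hab⟩ := hres s
      obtain ⟨t, ht⟩ := hmax _ hab
      rw [Submodule.mem_sup]
      refine ⟨algebraMap R S a + algebraMap R S b * θ, ?_, algebraMap R S ϖ * t, ?_, ?_⟩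
      · rw [Submodule.mem_span_pair]
        exact ⟨a, b, by simp [Algebra.smul_def]⟩
      · rw [← Algebra.smul_def]
        exact Submodule.smul_mem_smul (Ideal.mem_span_singleton_self ϖ) Submodule.mem_top
      · rw [← ht]; ring
  intro s
  obtain ⟨a, b, hab⟩ := Submodule.mem_span_pair.1 (key (Submodule.mem_top : s ∈ ⊤))
  exact ⟨a, b, by rw [← hab]; simp [Algebra.smul_def]⟩

end Nakayama

section Residue

variable {K L : Type*} [Field K] [Field L]

/-- A finite field `L` of order `q²` over a subfield `f(K)` of order `q` is spanned by `1, t` for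
any `t ∉ f(K)`: the map `(a, b) ↦ f a + f b · t` is injective, hence bijective by cardinality. -/
theorem surjective_add_mul_of_card [Finite L] (f : K →+* L) {q : ℕ} (hK : Nat.card K = q)
    (hL : Nat.card L = q ^ 2) {t : L} (ht : t ∉ Set.range f) (z : L) :
    ∃ a b : K, z = f a + f b * t := by
  let φ : K × K → L := fun p => f p.1 + f p.2 * t
  have hinj : Function.Injective φ := by
    rintro ⟨a, b⟩ ⟨a', b'⟩ h
    simp only [φ] at h
    by_cases hb : b = b'
    · subst hb
      have ha : f a = f a' := add_right_cancel h
      rw [f.injective ha]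
    · exfalso
      apply ht
      have hb' : f b - f b' ≠ 0 := by
        rw [sub_ne_zero]
        exact fun h' => hb (f.injective h')
      refine ⟨(a' - a) / (b - b'), ?_⟩
      rw [map_div₀, map_sub, map_sub, div_eq_iff hb']
      linear_combination (-1 : L) * h
  have hbij : Function.Bijective φ :=
    hinj.bijective_of_nat_card_le (by rw [Nat.card_prod, hK, hL, sq])
  obtain ⟨⟨a, b⟩, hab⟩ := hbij.2 z
  exact ⟨a, b, hab.symm⟩

end Residue

section Glue

variable {R S : Type*} [CommRing R] [CommRing S] [Algebra R S] [IsLocalRing R] [IsLocalRing S]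
  [IsLocalHom (algebraMap R S)]

/-- The residue-level spanning clause from the cardinalities `|k_R| = q`, `|k_S| = q²` and
`θ̄ ∉ k_R` (the image of the residue map of `algebraMap R S`). -/
theorem exists_sub_mem_maximalIdeal_of_card {q : ℕ} (hq : 1 ≤ q)
    (hR : Nat.card (ResidueField R) = q) (hS : Nat.card (ResidueField S) = q ^ 2) {θ : S}
    (hθ : residue S θ ∉ Set.range (ResidueField.map (algebraMap R S))) (s : S) :
    ∃ a b : R, s - (algebraMap R S a + algebraMap R S b * θ) ∈ maximalIdeal S := by
  haveI : Finite (ResidueField S) := Nat.finite_of_card_ne_zero (by rw [hS]; positivity)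
  obtain ⟨a₀, b₀, h⟩ :=
    surjective_add_mul_of_card (ResidueField.map (algebraMap R S)) hR hS hθ (residue S s)
  obtain ⟨a, rfl⟩ := residue_surjective a₀
  obtain ⟨b, rfl⟩ := residue_surjective b₀
  refine ⟨a, b, ?_⟩
  rw [← residue_eq_zero_iff, map_sub, map_add, map_mul, h, ResidueField.map_residue,
    ResidueField.map_residue]
  ring

/-- `θ − σ θ` is a unit as soon as its residue is non-zero. -/
theorem isUnit_sub_conj (σ : S ≃+* S) {θ : S} (h : residue S (θ - σ θ) ≠ 0) :
    IsUnit (θ - σ θ) :=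
  (residue_ne_zero_iff_isUnit _).1 h

end Glue

section DVR

variable {R S : Type*} [CommRing R] [CommRing S] [Algebra R S] [IsDomain R] [IsDomain S]
  [IsDiscreteValuationRing R] [IsDiscreteValuationRing S] [IsLocalHom (algebraMap R S)]
  [Module.Finite R S]

/-- THE UNRAMIFIED INTEGRAL BASIS on a pair of DVRs: `S` finite over `R`, `ϖ` a uniformiser of `R`
that stays a uniformiser of `S` (`e = 1`), residue cardinalities `q` and `q²`, `θ̄ ∉ k_R`; then
every `s ∈ S` is `a + b θ` with `a, b ∈ R`. -/
theorem exists_eq_add_mul {ϖ : R} (hϖ : Irreducible ϖ) (hϖS : Irreducible (algebraMap R S ϖ))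
    {q : ℕ} (hq : 1 ≤ q) (hR : Nat.card (ResidueField R) = q)
    (hS : Nat.card (ResidueField S) = q ^ 2) {θ : S}
    (hθ : residue S θ ∉ Set.range (ResidueField.map (algebraMap R S))) :
    ∀ s : S, ∃ a b : R, s = algebraMap R S a + algebraMap R S b * θ :=
  exists_eq_add_mul_of_residue
    (by rw [hϖ.maximalIdeal_eq]; exact Ideal.mem_span_singleton_self ϖ)
    (fun s hs => by
      rw [hϖS.maximalIdeal_eq, Ideal.mem_span_singleton'] at hs
      obtain ⟨t, ht⟩ := hs
      exact ⟨t, by rw [← ht, mul_comm]⟩)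
    (exists_sub_mem_maximalIdeal_of_card hq hR hS hθ)

variable (σ : S ≃+* S)

/-- Hilbert 90 at level 0 on `Sˣ` on these hypotheses (`θ̄ ∉ k_R`, `σ` moves `θ` modulo `𝔪_S`). -/
theorem hilbert90_units (hσσ : ∀ s, σ (σ s) = s) {θ : S} (hθσ : residue S (θ - σ θ) ≠ 0) :
    ∀ z : Sˣ, conjUnits σ z = z⁻¹ → ∃ x, conjQuot σ x = z :=
  T5LocalUnitHilbert90.hilbert90_units σ hσσ (isUnit_sub_conj σ hθσ)

/-- N5.15.2 (A15) / N5.T3: `[E¹ : E¹ ∩ U^n] = (q+1)q^{n−1}` (`n ≥ 1`) on the hypotheses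
finiteness, `e = 1`, residue cardinalities `q`, `q²`, `θ̄ ∉ k_R`, `σ` moves `θ̄`. -/
theorem relIndex_range_inf_higherUnits_eq
    (hσR : ∀ r : R, σ (algebraMap R S r) = algebraMap R S r) (hσσ : ∀ s, σ (σ s) = s)
    {θ : S} (hθ : residue S θ ∉ Set.range (ResidueField.map (algebraMap R S)))
    (hθσ : residue S (θ - σ θ) ≠ 0) (hinj : Function.Injective (algebraMap R S)) {ϖ : R}
    (hϖ : Irreducible ϖ) (hϖS : Irreducible (algebraMap R S ϖ)) {q : ℕ} (hq : 2 ≤ q)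
    (hR : Nat.card (ResidueField R) = q) (hS : Nat.card (ResidueField S) = q ^ 2) {n : ℕ}
    (hn : 1 ≤ n) :
    ((MonoidHom.mk' (conjQuot σ) (conjQuot_mul σ)).range ⊓
        higherUnits (algebraMap R S ϖ) n).relIndex
        (MonoidHom.mk' (conjQuot σ) (conjQuot_mul σ)).range = (q + 1) * q ^ (n - 1) :=
  T5LocalUnitHilbert90.relIndex_range_inf_higherUnits_eq σ hσR hσσ (isUnit_sub_conj σ hθσ)
    (exists_eq_add_mul hϖ hϖS (by omega) hR hS hθ) hinj hϖ hϖS hq hR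
    (by rw [Nat.card_units, hR]) hS (by rw [Nat.card_units, hS]) hn

/-- `|E¹/(E¹ ∩ U²)| = (q+1)q`. -/
theorem relIndex_range_inf_higherUnits_two
    (hσR : ∀ r : R, σ (algebraMap R S r) = algebraMap R S r) (hσσ : ∀ s, σ (σ s) = s)
    {θ : S} (hθ : residue S θ ∉ Set.range (ResidueField.map (algebraMap R S)))
    (hθσ : residue S (θ - σ θ) ≠ 0) (hinj : Function.Injective (algebraMap R S)) {ϖ : R}
    (hϖ : Irreducible ϖ) (hϖS : Irreducible (algebraMap R S ϖ)) {q : ℕ} (hq : 2 ≤ q)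
    (hR : Nat.card (ResidueField R) = q) (hS : Nat.card (ResidueField S) = q ^ 2) :
    ((MonoidHom.mk' (conjQuot σ) (conjQuot_mul σ)).range ⊓
        higherUnits (algebraMap R S ϖ) 2).relIndex
        (MonoidHom.mk' (conjQuot σ) (conjQuot_mul σ)).range = (q + 1) * q :=
  T5LocalUnitHilbert90.relIndex_range_inf_higherUnits_two σ hσR hσσ (isUnit_sub_conj σ hθσ)
    (exists_eq_add_mul hϖ hϖS (by omega) hR hS hθ) hinj hϖ hϖS hq hR
    (by rw [Nat.card_units, hR]) hS (by rw [Nat.card_units, hS])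

/-- `|G/G¹| = |E¹/(E¹ ∩ U¹)| = q + 1`. -/
theorem relIndex_range_inf_higherUnits_one
    (hσR : ∀ r : R, σ (algebraMap R S r) = algebraMap R S r) (hσσ : ∀ s, σ (σ s) = s)
    {θ : S} (hθ : residue S θ ∉ Set.range (ResidueField.map (algebraMap R S)))
    (hθσ : residue S (θ - σ θ) ≠ 0) (hinj : Function.Injective (algebraMap R S)) {ϖ : R}
    (hϖ : Irreducible ϖ) (hϖS : Irreducible (algebraMap R S ϖ)) {q : ℕ} (hq : 2 ≤ q)
    (hR : Nat.card (ResidueField R) = q) (hS : Nat.card (ResidueField S) = q ^ 2) :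
    ((MonoidHom.mk' (conjQuot σ) (conjQuot_mul σ)).range ⊓
        higherUnits (algebraMap R S ϖ) 1).relIndex
        (MonoidHom.mk' (conjQuot σ) (conjQuot_mul σ)).range = q + 1 :=
  T5LocalUnitHilbert90.relIndex_range_inf_higherUnits_one σ hσR hσσ (isUnit_sub_conj σ hθσ)
    (exists_eq_add_mul hϖ hϖS (by omega) hR hS hθ) hinj hϖ hϖS hq hR
    (by rw [Nat.card_units, hR]) hS (by rw [Nat.card_units, hS])

/-- `|G¹| = |(E¹ ∩ U¹)/(E¹ ∩ U²)| = q`. -/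
theorem relIndex_inf_two_inf_one
    (hσR : ∀ r : R, σ (algebraMap R S r) = algebraMap R S r) (hσσ : ∀ s, σ (σ s) = s)
    {θ : S} (hθ : residue S θ ∉ Set.range (ResidueField.map (algebraMap R S)))
    (hθσ : residue S (θ - σ θ) ≠ 0) (hinj : Function.Injective (algebraMap R S)) {ϖ : R}
    (hϖ : Irreducible ϖ) (hϖS : Irreducible (algebraMap R S ϖ)) {q : ℕ} (hq : 2 ≤ q)
    (hR : Nat.card (ResidueField R) = q) (hS : Nat.card (ResidueField S) = q ^ 2) :
    ((MonoidHom.mk' (conjQuot σ) (conjQuot_mul σ)).range ⊓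
        higherUnits (algebraMap R S ϖ) 2).relIndex
        ((MonoidHom.mk' (conjQuot σ) (conjQuot_mul σ)).range ⊓
          higherUnits (algebraMap R S ϖ) 1) = q :=
  T5LocalUnitHilbert90.relIndex_inf_two_inf_one σ hσR hσσ (isUnit_sub_conj σ hθσ)
    (exists_eq_add_mul hϖ hϖS (by omega) hR hS hθ) hinj hϖ hϖS hq hR
    (by rw [Nat.card_units, hR]) hS (by rw [Nat.card_units, hS])

end DVR

end Summit.Ventures.HodgeRepro2.T5UnramifiedIntegralBasis
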